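import Summits.QuantumFields.YangMills.Theorems.UnitScaleTiltFluctuationComparisonRegPrOneTower

/-!
# Route `ReplicaVarianceTilt` — crux `HeightChiSqL` (stmt-QuantumFields-26133), registered stub `stub_acIntegrable`:
# CHI-SQUARE DATA PROCESSING along Bałaban's Radon–Nikodym tower — the stub's integrability conjunct REDUCES to square-integrability of the
# one-step renormalised weight `w_K` on the UV-small history (helper `--supports stmt-QuantumFields-26133`; the stub stays open)

Width seat `ym-line-sfw-p2-w3` gen 21 (home cell `ym-idea-1`; R3 RECORD rung — no summit, no rung and no crux is proved here; the YM mass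
gap is NOT proved by any of this).  Companion of `ReplicaVarianceTiltHeightChiSqLAbsCont` (the a.c. conjunct, unconditional) and of
`ReplicaVarianceTiltHeightChiSqLOneStepWindow` (the converse at `m = 1` and the equivalence in the stub's prefix).
Notation (for readability only; every statement below is spelled in the tree's vocabulary, no definition is introduced): run `K`,
comparison height `n` (`= ⌊K/m⌋` in the stub), `S = histGood K n`, `b = e^{−β_K A}` (`boltzmann`), `w_K` = the one-step renormalised weight
of run `K+1` read on run `K`'s finest lattice, `U ↦ resDensity F γ (K+1) {PlaqSmall θ(K+1)} 1 (e₀⁻¹ U)` (tree `LogComparisonOneTower`,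
[King1986] §3.2), `T^{k}` = run `K`'s Radon–Nikodym tower `towerDensity F K · k`, `ρ⁰`/`ρ¹` = the two runs' restricted height densities
`heightDensity` on `histGood K n` / `histGood (K+1) n`.

* §1 **CHI-SQUARE DATA PROCESSING ALONG THE TOWER** (`integrable_sq_div_towerDensity`): for non-negative measurable integrable initial
  densities `f, g` with `g = 0 ⇒ f = 0` and `∫ f²/g dU < ∞`, at every level `k` of the standing range `(T^{k}f)²/T^{k}g` is integrable and
  `∫ (T^{k}f)²/(T^{k}g) dV_k ≤ ∫ f²/g dU`.  Proof with LINEAR identities only (the transports are Radon–Nikodym derivatives, known through the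
  push-forward identity [Balaban1985Averaging] (10) alone): with `a = T^{k}f`, `c = T^{k}g` and the bounded tests `φ_N = min(N, a/c)`,
  `I_N := ∫ a·φ_N = ∫ f·φ_N(Ū^{k}) ≤ ½∫ g·φ_N(Ū^{k})² + ½∫ f²/g = ½∫ c·φ_N² + ½∫ f²/g ≤ ½ I_N + ½∫ f²/g` (AM–GM pointwise under `dU`, then
  `c·φ_N² ≤ a·φ_N`), so `I_N ≤ ∫ f²/g`; monotone convergence in `N` (`a·φ_N ↑ a²/c`).
* §2 at the comparison height (`integrable_chiSq_of_oneStepWeightSq`): `∫_S w_K²/b dU < ∞` ⇒ `(ρ¹)²/ρ⁰` integrable on the `n`-th tower's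
  finest lattice, with `∫ (ρ¹)²/ρ⁰ ≤ ∫_S w_K²/b` (one-tower normal form `heightDensity_succ_ae_eq` + §1 at `k = K − n` + the measure-preserving
  level identification `fieldShift`).
HONEST READING: the hypothesis of §2 is NOT regularity bookkeeping — it is an `L²` statement about the image law of ONE (0.4) block averaging
restricted to the finest small-field window (`w_K ≤ d(avg_* dU)/dV` there), of which the tree knows absolute continuity only (`HaarAC`,
`BlockAveragingEMLFibreLawSUN`; exact Haar compatibility «E6′» open, `AveragingImageLawGaugeInvariance`); the sibling file shows the stub is
EQUIVALENT to it.  No estimate of Bałaban's is used or asserted anywhere in this file.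

References: T. Bałaban, CMP 98 (1985) 17–51 [Balaban1985Averaging] ((10) p.19); CMP 102 (1985) 255–275 [Balaban1985UV3] ((2) p.256,
(6)–(7) p.257); C. King, CMP 102 (1986) 649–677 [King1986] (§3.2 p.656).
-/
noncomputable section

open MeasureTheory Filter Topology
open scoped ENNReal
open Literature.MathematicalPhysics.QuantumFieldTheory.Balaban1983to89
open Literature.MathematicalPhysics.QuantumFieldTheory.Balaban1983to89.T3ContinuumYM3Torus
open Literature.MathematicalPhysics.QuantumFieldTheory.Balaban1983to89.T3LevelShift
open Literature.MathematicalPhysics.QuantumFieldTheory.Balaban1983to89.T3UnitLawDensityEML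
open Literature.MathematicalPhysics.QuantumFieldTheory.Balaban1983to89.T3UnitScaleTilt
open Literature.MathematicalPhysics.QuantumFieldTheory.Balaban1983to89.T3RestrictedUnitDensity
open Literature.MathematicalPhysics.QuantumFieldTheory.Balaban1983to89.T3TiltDescent
open Literature.MathematicalPhysics.QuantumFieldTheory.Balaban1983to89.Missing
open Literature.MathematicalPhysics.QuantumFieldTheory.Balaban1983to89.T4Continuum
open Summit.QuantumFields.YangMills.Theorems.LogComparisonOneTower

namespace Summit.QuantumFields.YangMills.Theorems.HeightChiSqLDataProcessing

/-! ## §0 Two pointwise inequalities -/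

/-- AM–GM in the form `x·φ ≤ ½(g·φ² + x²/g)` for `g > 0`. [folklore] -/
theorem mul_le_half_add {x φ g : ℝ} (hg : 0 < g) : x * φ ≤ (g * φ ^ 2 + x ^ 2 / g) / 2 := by
  have key : (g * φ ^ 2 + x ^ 2 / g) / 2 - x * φ = (φ * g - x) ^ 2 / (2 * g) := by
    field_simp
    ring
  have hnn : 0 ≤ (φ * g - x) ^ 2 / (2 * g) := by positivity
  linarith

/-- `c·(min N (a/c))² ≤ a·min N (a/c)` for `a, c, N ≥ 0` (with `a/0 = 0`). [folklore] -/
theorem mul_min_sq_le {a c : ℝ} (ha : 0 ≤ a) (hc : 0 ≤ c) {N : ℝ} (hN : 0 ≤ N) :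
    c * (min N (a / c)) ^ 2 ≤ a * min N (a / c) := by
  rcases hc.eq_or_lt with h | hc'
  · rw [← h]
    simp only [div_zero, zero_mul]
    exact mul_nonneg ha (le_min hN le_rfl)
  · have hm0 : 0 ≤ min N (a / c) := le_min hN (div_nonneg ha hc'.le)
    have hle : c * min N (a / c) ≤ a := by
      calc c * min N (a / c) ≤ c * (a / c) := mul_le_mul_of_nonneg_left (min_le_right _ _) hc'.le
        _ = a := by field_simp
    calc c * (min N (a / c)) ^ 2 = (c * min N (a / c)) * min N (a / c) := by ring
      _ ≤ a * min N (a / c) := mul_le_mul_of_nonneg_right hle hm0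

/-! ## §1 Chi-square data processing along the Radon–Nikodym tower -/

section Tower

variable (F : T3Family) (K : ℕ) {f g : Density (F.P K) 0 (Matrix.specialUnitaryGroup (Fin 2) ℂ)}
  (hf0 : ∀ U, 0 ≤ f U) (hfm : Measurable f) (hfi : Integrable f (fieldMeasure (F.P K) 0 (Matrix.specialUnitaryGroup (Fin 2) ℂ)))
  (hg0 : ∀ U, 0 ≤ g U) (hgm : Measurable g) (hgi : Integrable g (fieldMeasure (F.P K) 0 (Matrix.specialUnitaryGroup (Fin 2) ℂ)))
  (hzero : ∀ U, g U = 0 → f U = 0)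
  (hsq : Integrable (fun U => f U ^ 2 / g U) (fieldMeasure (F.P K) 0 (Matrix.specialUnitaryGroup (Fin 2) ℂ)))
  {k : ℕ} (hk : k ≤ F.m + K)

include hf0 hfm hfi hg0 hgm in
/-- The truncated products `T^{k}f · min(N, T^{k}f/T^{k}g)` are integrable (bounded factor times an integrable density). [cite: Balaban1985Averaging, (10) p.19] -/
theorem integrable_towerDensity_mul_min (hk : k ≤ F.m + K) {N : ℝ} (hN : 0 ≤ N) :
    Integrable (fun W => towerDensity F K f k W * min N (towerDensity F K f k W / towerDensity F K g k W))
      (fieldMeasure (F.P K) k (Matrix.specialUnitaryGroup (Fin 2) ℂ)) := by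
  have ham : Measurable (towerDensity F K f k) := measurable_towerDensity F K hf0 hfm k
  have hcm : Measurable (towerDensity F K g k) := measurable_towerDensity F K hg0 hgm k
  refine (integrable_towerDensity F K hfi k hk).mul_bdd (c := N) (measurable_const.min (ham.div hcm)).aestronglyMeasurable
    (ae_of_all _ fun W => ?_)
  rw [Real.norm_eq_abs, abs_of_nonneg (le_min hN (div_nonneg (towerDensity_nonneg F K hf0 k W) (towerDensity_nonneg F K hg0 k W)))]
  exact min_le_left _ _

include hf0 hfm hfi hg0 hgm hgi hzero hsq in
/-- **THE TRUNCATED INTEGRALS ARE DOMINATED**: with `a = T^{k}f`, `c = T^{k}g`, `φ_N = min(N, a/c)`, `∫ a·φ_N dV_k ≤ ∫ f²/g dU` for every `N ≥ 0`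
(`∫ a·φ_N = ∫ f·φ_N(Ū^k) ≤ ½∫ g·φ_N(Ū^k)² + ½∫ f²/g = ½∫ c·φ_N² + ½∫ f²/g ≤ ½∫ a·φ_N + ½∫ f²/g`). [cite: Balaban1985Averaging, (10) p.19] -/
theorem integral_towerDensity_mul_min_le (hk : k ≤ F.m + K) {N : ℝ} (hN : 0 ≤ N) :
    ∫ W, towerDensity F K f k W * min N (towerDensity F K f k W / towerDensity F K g k W)
        ∂fieldMeasure (F.P K) k (Matrix.specialUnitaryGroup (Fin 2) ℂ) ≤
      ∫ U, f U ^ 2 / g U ∂fieldMeasure (F.P K) 0 (Matrix.specialUnitaryGroup (Fin 2) ℂ) := by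
  set μ₀ := fieldMeasure (F.P K) 0 (Matrix.specialUnitaryGroup (Fin 2) ℂ) with hμ₀
  set μ := fieldMeasure (F.P K) k (Matrix.specialUnitaryGroup (Fin 2) ℂ) with hμ
  set itr : GaugeField (F.P K) 0 (Matrix.specialUnitaryGroup (Fin 2) ℂ) → GaugeField (F.P K) k (Matrix.specialUnitaryGroup (Fin 2) ℂ) :=
    Averaging.iter (fun i => BlockAveraging.blockAvg (P := F.P K) (j := i) ℰp) k with hitr
  have hmi : Measurable itr := measurable_iter _ (fun i => measurable_blockAvg F K i) k
  set a : GaugeField (F.P K) k (Matrix.specialUnitaryGroup (Fin 2) ℂ) → ℝ := towerDensity F K f k with ha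
  set c : GaugeField (F.P K) k (Matrix.specialUnitaryGroup (Fin 2) ℂ) → ℝ := towerDensity F K g k with hc
  have ha0 : ∀ W, 0 ≤ a W := towerDensity_nonneg F K hf0 k
  have hc0 : ∀ W, 0 ≤ c W := towerDensity_nonneg F K hg0 k
  have ham : Measurable a := measurable_towerDensity F K hf0 hfm k
  have hcm : Measurable c := measurable_towerDensity F K hg0 hgm k
  have hci : Integrable c μ := integrable_towerDensity F K hgi k hk
  set φ : GaugeField (F.P K) k (Matrix.specialUnitaryGroup (Fin 2) ℂ) → ℝ := fun W => min N (a W / c W) with hφ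
  have hφm : Measurable φ := measurable_const.min (ham.div hcm)
  have hφ0 : ∀ W, 0 ≤ φ W := fun W => le_min hN (div_nonneg (ha0 W) (hc0 W))
  have hφN : ∀ W, φ W ≤ N := fun W => min_le_left _ _
  have hφb : ∃ C : ℝ, ∀ W, |φ W| ≤ C := ⟨N, fun W => by rw [abs_of_nonneg (hφ0 W)]; exact hφN W⟩
  have hφ2m : Measurable fun W => φ W ^ 2 := hφm.pow_const 2
  have hφ2N : ∀ W, φ W ^ 2 ≤ N ^ 2 := fun W => pow_le_pow_left₀ (hφ0 W) (hφN W) 2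
  have hφ2b : ∃ C : ℝ, ∀ W, |φ W ^ 2| ≤ C := ⟨N ^ 2, fun W => by rw [abs_of_nonneg (sq_nonneg _)]; exact hφ2N W⟩
  -- the two push-forward identities
  have hI : ∫ W, a W * φ W ∂μ = ∫ U, f U * φ (itr U) ∂μ₀ := integral_towerDensity_mul F K hfi k hk φ hφm hφb
  have hJ : ∫ W, c W * φ W ^ 2 ∂μ = ∫ U, g U * φ (itr U) ^ 2 ∂μ₀ :=
    integral_towerDensity_mul F K hgi k hk (fun W => φ W ^ 2) hφ2m hφ2b
  -- integrability of the players
  have haφi : Integrable (fun W => a W * φ W) μ := integrable_towerDensity_mul_min F K hf0 hfm hfi hg0 hgm hk hN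
  have hcφi : Integrable (fun W => c W * φ W ^ 2) μ :=
    hci.mul_bdd hφ2m.aestronglyMeasurable (ae_of_all _ fun W => by
      rw [Real.norm_eq_abs, abs_of_nonneg (sq_nonneg _)]; exact hφ2N W)
  have hfφi : Integrable (fun U => f U * φ (itr U)) μ₀ :=
    hfi.mul_bdd (hφm.comp hmi).aestronglyMeasurable (ae_of_all _ fun U => by
      rw [Real.norm_eq_abs, abs_of_nonneg (hφ0 _)]; exact hφN _)
  have hgφi : Integrable (fun U => g U * φ (itr U) ^ 2) μ₀ :=
    hgi.mul_bdd (hφ2m.comp hmi).aestronglyMeasurable (ae_of_all _ fun U => by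
      rw [Real.norm_eq_abs, abs_of_nonneg (sq_nonneg _)]; exact hφ2N _)
  -- step 1: AM–GM under `dU`
  have h1 : ∫ U, f U * φ (itr U) ∂μ₀ ≤ ∫ U, (g U * φ (itr U) ^ 2 + f U ^ 2 / g U) / 2 ∂μ₀ := by
    refine integral_mono hfφi ((hgφi.add hsq).div_const 2) fun U => ?_
    show f U * φ (itr U) ≤ (g U * φ (itr U) ^ 2 + f U ^ 2 / g U) / 2
    rcases (hg0 U).eq_or_lt with h | h
    · rw [hzero U h.symm, ← h]
      simp
    · exact mul_le_half_add h
  have h1' : ∫ U, (g U * φ (itr U) ^ 2 + f U ^ 2 / g U) / 2 ∂μ₀ =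
      (∫ U, g U * φ (itr U) ^ 2 ∂μ₀ + ∫ U, f U ^ 2 / g U ∂μ₀) / 2 := by
    rw [integral_div, integral_add hgφi hsq]
  -- step 2: `∫ c·φ² ≤ ∫ a·φ`
  have h2 : ∫ W, c W * φ W ^ 2 ∂μ ≤ ∫ W, a W * φ W ∂μ :=
    integral_mono hcφi haφi fun W => mul_min_sq_le (ha0 W) (hc0 W) hN
  -- combine
  have h3 : ∫ W, a W * φ W ∂μ ≤ (∫ W, a W * φ W ∂μ + ∫ U, f U ^ 2 / g U ∂μ₀) / 2 := by
    calc ∫ W, a W * φ W ∂μ = ∫ U, f U * φ (itr U) ∂μ₀ := hI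
      _ ≤ _ := h1
      _ = _ := h1'
      _ = (∫ W, c W * φ W ^ 2 ∂μ + ∫ U, f U ^ 2 / g U ∂μ₀) / 2 := by rw [hJ]
      _ ≤ (∫ W, a W * φ W ∂μ + ∫ U, f U ^ 2 / g U ∂μ₀) / 2 := by linarith [h2]
  linarith [h3]

include hf0 hfm hfi hg0 hgm hgi hzero hsq in
/-- **CHI-SQUARE DATA PROCESSING ALONG BAŁABAN'S TOWER**: for non-negative measurable integrable initial densities `f, g` with `g = 0 ⇒ f = 0`
and `∫ f²/g dU < ∞`, at every level `k` of the standing range `(T^{k}f)²/T^{k}g` is integrable and `∫ (T^{k}f)²/T^{k}g dV_k ≤ ∫ f²/g dU`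
(monotone convergence on the truncations of `integral_towerDensity_mul_min_le`). [cite: Balaban1985Averaging, (10) p.19] -/
theorem integrable_sq_div_towerDensity (hk : k ≤ F.m + K) :
    Integrable (fun W => towerDensity F K f k W ^ 2 / towerDensity F K g k W)
        (fieldMeasure (F.P K) k (Matrix.specialUnitaryGroup (Fin 2) ℂ)) ∧
      ∫ W, towerDensity F K f k W ^ 2 / towerDensity F K g k W ∂fieldMeasure (F.P K) k (Matrix.specialUnitaryGroup (Fin 2) ℂ) ≤
        ∫ U, f U ^ 2 / g U ∂fieldMeasure (F.P K) 0 (Matrix.specialUnitaryGroup (Fin 2) ℂ) := by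
  set μ₀ := fieldMeasure (F.P K) 0 (Matrix.specialUnitaryGroup (Fin 2) ℂ) with hμ₀
  set μ := fieldMeasure (F.P K) k (Matrix.specialUnitaryGroup (Fin 2) ℂ) with hμ
  set a : GaugeField (F.P K) k (Matrix.specialUnitaryGroup (Fin 2) ℂ) → ℝ := towerDensity F K f k with ha
  set c : GaugeField (F.P K) k (Matrix.specialUnitaryGroup (Fin 2) ℂ) → ℝ := towerDensity F K g k with hc
  set C : ℝ := ∫ U, f U ^ 2 / g U ∂μ₀ with hC
  have ha0 : ∀ W, 0 ≤ a W := towerDensity_nonneg F K hf0 k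
  have hc0 : ∀ W, 0 ≤ c W := towerDensity_nonneg F K hg0 k
  have ham : Measurable a := measurable_towerDensity F K hf0 hfm k
  have hcm : Measurable c := measurable_towerDensity F K hg0 hgm k
  have hid : (fun W => a W ^ 2 / c W) = fun W => a W * (a W / c W) := by
    funext W; rw [sq, mul_div_assoc]
  -- the truncations, as `ℝ≥0∞`-valued functions
  set G : ℕ → GaugeField (F.P K) k (Matrix.specialUnitaryGroup (Fin 2) ℂ) → ℝ≥0∞ :=
    fun N W => ENNReal.ofReal (a W * min (N : ℝ) (a W / c W)) with hG
  have hGm : ∀ N : ℕ, Measurable (G N) := fun N =>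
    (ham.mul (measurable_const.min (ham.div hcm))).ennreal_ofReal
  have hGmono : Monotone G := by
    intro N M hNM W
    refine ENNReal.ofReal_le_ofReal (mul_le_mul_of_nonneg_left ?_ (ha0 W))
    exact min_le_min_right _ (by exact_mod_cast hNM)
  have hsup : ∀ W, (⨆ N : ℕ, G N W) = ENNReal.ofReal (a W * (a W / c W)) := by
    intro W
    refine le_antisymm (iSup_le fun N => ENNReal.ofReal_le_ofReal
      (mul_le_mul_of_nonneg_left (min_le_right _ _) (ha0 W))) ?_
    obtain ⟨N, hN⟩ := exists_nat_ge (a W / c W)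
    refine le_iSup_of_le N (le_of_eq ?_)
    show ENNReal.ofReal (a W * (a W / c W)) = ENNReal.ofReal (a W * min (N : ℝ) (a W / c W))
    rw [min_eq_right hN]
  have hbound : ∀ N : ℕ, ∫⁻ W, G N W ∂μ ≤ ENNReal.ofReal C := by
    intro N
    have hN : (0 : ℝ) ≤ N := Nat.cast_nonneg N
    have hnn : 0 ≤ᵐ[μ] fun W => a W * min (N : ℝ) (a W / c W) :=
      ae_of_all _ fun W => mul_nonneg (ha0 W) (le_min hN (div_nonneg (ha0 W) (hc0 W)))
    rw [hG]
    rw [← ofReal_integral_eq_lintegral_ofReal (integrable_towerDensity_mul_min F K hf0 hfm hfi hg0 hgm hk hN) hnn]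
    exact ENNReal.ofReal_le_ofReal (integral_towerDensity_mul_min_le F K hf0 hfm hfi hg0 hgm hgi hzero hsq hk hN)
  have hlin : ∫⁻ W, ENNReal.ofReal (a W * (a W / c W)) ∂μ ≤ ENNReal.ofReal C := by
    have heq : (fun W => ENNReal.ofReal (a W * (a W / c W))) = fun W => ⨆ N : ℕ, G N W := by
      funext W; rw [hsup W]
    rw [heq, lintegral_iSup hGm hGmono]
    exact iSup_le hbound
  have hmeas : Measurable fun W => a W * (a W / c W) := ham.mul (ham.div hcm)
  have hnn : 0 ≤ᵐ[μ] fun W => a W * (a W / c W) :=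
    ae_of_all _ fun W => mul_nonneg (ha0 W) (div_nonneg (ha0 W) (hc0 W))
  have hint : Integrable (fun W => a W * (a W / c W)) μ :=
    ⟨hmeas.aestronglyMeasurable, (hasFiniteIntegral_iff_ofReal hnn).mpr (lt_of_le_of_lt hlin ENNReal.ofReal_lt_top)⟩
  have hC0 : 0 ≤ C := integral_nonneg fun U => div_nonneg (sq_nonneg _) (hg0 U)
  refine ⟨by rw [hid]; exact hint, ?_⟩
  rw [hid, integral_eq_lintegral_of_nonneg_ae hnn hmeas.aestronglyMeasurable]
  calc (∫⁻ W, ENNReal.ofReal (a W * (a W / c W)) ∂μ).toReal ≤ (ENNReal.ofReal C).toReal :=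
        ENNReal.toReal_mono ENNReal.ofReal_ne_top hlin
    _ = C := ENNReal.toReal_ofReal hC0

end Tower

/-! ## §2 At the comparison height: the two consecutive runs -/

section Height

variable (F : T3Family) {γ : ℝ} (hγ : 0 ≤ γ) (K : ℕ) (θ : ℕ → ℝ) {n : ℕ} (hK : n ≤ K)

/-- UV-small histories are monotone in the number of free top steps: fewer free steps, more constraints. [cite: Balaban1985UV3, (7) p.257] -/
theorem histGood_mono_height {n n' : ℕ} (hnn' : n ≤ n') : histGood F ℰp θ K n ⊆ histGood F ℰp θ K n' := by
  intro U hU j hj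
  exact hU j (by omega)

include hγ

/-- **THE INTEGRABILITY CONJUNCT ⇐ SQUARE-INTEGRABILITY OF THE ONE-STEP WEIGHT ON THE UV-SMALL HISTORY**: with `S = histGood K n`,
`b = e^{−β_K A}` and `w_K` the one-step renormalised weight of run `K+1` read on run `K`'s finest lattice, `∫_S w_K²/b dU < ∞` implies that
the chi-square integrand `(ρ¹)²/ρ⁰` of the two runs' restricted height densities at the comparison height is integrable, with
`∫ (ρ¹)²/ρ⁰ dV^{(n)} ≤ ∫_S w_K²/b dU` (one-tower normal form + §1 + the measure-preserving level identification). [cite: King1986, §3.2 p.656] -/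
theorem integrable_chiSq_of_oneStepWeightSq
    (hsq : Integrable ((histGood F ℰp θ K n).indicator fun U =>
        resDensity F γ (K + 1) {U' | PlaqSmall (θ (K + 1)) U'} 1
            (fieldShift (F.sitesPerDir_eq (m := F.m) (K := K + 1) (j := 1) (m' := F.m) (K' := K) (j' := 0) (by omega)) U) ^ 2 /
          boltzmann (F.P K) ((F.scheme ℰp γ).β K) U)
      (fieldMeasure (F.P K) 0 (Matrix.specialUnitaryGroup (Fin 2) ℂ))) :
    Integrable (fun V => heightDensity F γ (hK.trans (Nat.le_succ K)) (histGood F ℰp θ (K + 1) n) V ^ 2 /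
        heightDensity F γ hK (histGood F ℰp θ K n) V) (fieldMeasure (F.P n) 0 (Matrix.specialUnitaryGroup (Fin 2) ℂ)) ∧
      ∫ V, heightDensity F γ (hK.trans (Nat.le_succ K)) (histGood F ℰp θ (K + 1) n) V ^ 2 /
          heightDensity F γ hK (histGood F ℰp θ K n) V ∂fieldMeasure (F.P n) 0 (Matrix.specialUnitaryGroup (Fin 2) ℂ) ≤
        ∫ U, (histGood F ℰp θ K n).indicator (fun U =>
          resDensity F γ (K + 1) {U' | PlaqSmall (θ (K + 1)) U'} 1
              (fieldShift (F.sitesPerDir_eq (m := F.m) (K := K + 1) (j := 1) (m' := F.m) (K' := K) (j' := 0) (by omega)) U) ^ 2 /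
            boltzmann (F.P K) ((F.scheme ℰp γ).β K) U) U ∂fieldMeasure (F.P K) 0 (Matrix.specialUnitaryGroup (Fin 2) ℂ) := by
  have hS := measurableSet_histGood F ℰp measurableE_ℰp θ K n
  set μ₀ := fieldMeasure (F.P K) 0 (Matrix.specialUnitaryGroup (Fin 2) ℂ) with hμ₀
  set S := histGood F ℰp θ K n with hSdef
  set b : Density (F.P K) 0 (Matrix.specialUnitaryGroup (Fin 2) ℂ) := S.indicator (boltzmann (F.P K) ((F.scheme ℰp γ).β K)) with hb
  set w : Density (F.P K) 0 (Matrix.specialUnitaryGroup (Fin 2) ℂ) := S.indicator (fun U => resDensity F γ (K + 1) {U' | PlaqSmall (θ (K + 1)) U'} 1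
      (fieldShift (F.sitesPerDir_eq (m := F.m) (K := K + 1) (j := 1) (m' := F.m) (K' := K) (j' := 0) (by omega)) U)) with hw
  have hb0 : ∀ U, 0 ≤ b U := indicator_boltzmann_nonneg F γ K S
  have hbm : Measurable b := (measurable_boltzmann RegularGaugeGroup.measurable_reTr _ _).indicator hS
  have hbi : Integrable b μ₀ :=
    (integrable_boltzmann RegularGaugeGroup.measurable_reTr _ (F.scheme_β_nonneg ℰp hγ K)).indicator hS
  have hw0 : ∀ U, 0 ≤ w U := fun U => Set.indicator_nonneg (fun U' _ => oneStepWeight_nonneg F γ K θ U') U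
  have hwm : Measurable w := (measurable_oneStepWeight F γ K θ).indicator hS
  have hwi : Integrable w μ₀ := integrable_indicator_oneStepWeight F K θ hγ hS
  have hzero : ∀ U, b U = 0 → w U = 0 := by
    intro U hU
    by_cases hUS : U ∈ S
    · exfalso
      rw [hb, Set.indicator_of_mem hUS] at hU
      exact (boltzmann_pos (F.P K) ((F.scheme ℰp γ).β K) U).ne' hU
    · rw [hw, Set.indicator_of_notMem hUS]
  have hfg : (fun U => w U ^ 2 / b U) = S.indicator (fun U =>
      resDensity F γ (K + 1) {U' | PlaqSmall (θ (K + 1)) U'} 1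
          (fieldShift (F.sitesPerDir_eq (m := F.m) (K := K + 1) (j := 1) (m' := F.m) (K' := K) (j' := 0) (by omega)) U) ^ 2 /
        boltzmann (F.P K) ((F.scheme ℰp γ).β K) U) := by
    funext U
    by_cases hU : U ∈ S
    · simp only [hw, hb, Set.indicator_of_mem hU]
    · simp only [hw, hb, Set.indicator_of_notMem hU]
      simp
  have hsq' : Integrable (fun U => w U ^ 2 / b U) μ₀ := by rw [hfg]; exact hsq
  obtain ⟨hint, hle⟩ := integrable_sq_div_towerDensity F K hw0 hwm hwi hb0 hbm hbi hzero hsq' (k := K - n) (by omega)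
  -- transport along the level identification and the one-tower normal form
  have hup := F.sitesPerDir_eq (m := F.m) (K := K) (j := K - n) (m' := F.m) (K' := n) (j' := 0) (by omega)
  have hmp := measurePreserving_fieldShift (G := Matrix.specialUnitaryGroup (Fin 2) ℂ) hup
  have hcomp := hmp.integrable_comp_of_integrable hint
  have hsucc := heightDensity_succ_ae_eq F hγ K θ hK
  have hae : (fun V => heightDensity F γ (hK.trans (Nat.le_succ K)) (histGood F ℰp θ (K + 1) n) V ^ 2 /
        heightDensity F γ hK (histGood F ℰp θ K n) V) =ᵐ[fieldMeasure (F.P n) 0 (Matrix.specialUnitaryGroup (Fin 2) ℂ)]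
      (fun V => towerDensity F K w (K - n) (fieldShift hup V) ^ 2 / towerDensity F K b (K - n) (fieldShift hup V)) := by
    filter_upwards [hsucc] with V hV
    rw [hV]
    rfl
  have hcomp' : Integrable
      (fun V => towerDensity F K w (K - n) (fieldShift hup V) ^ 2 / towerDensity F K b (K - n) (fieldShift hup V))
      (fieldMeasure (F.P n) 0 (Matrix.specialUnitaryGroup (Fin 2) ℂ)) := hcomp
  refine ⟨hcomp'.congr hae.symm, ?_⟩
  have hcv := integral_comp_fieldShift (G := Matrix.specialUnitaryGroup (Fin 2) ℂ) hup
    (fun W => towerDensity F K w (K - n) W ^ 2 / towerDensity F K b (K - n) W)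
  rw [integral_congr_ae hae, ← hfg]
  calc ∫ V, towerDensity F K w (K - n) (fieldShift hup V) ^ 2 / towerDensity F K b (K - n) (fieldShift hup V)
          ∂fieldMeasure (F.P n) 0 (Matrix.specialUnitaryGroup (Fin 2) ℂ)
        = ∫ W, towerDensity F K w (K - n) W ^ 2 / towerDensity F K b (K - n) W
          ∂fieldMeasure (F.P K) (K - n) (Matrix.specialUnitaryGroup (Fin 2) ℂ) := hcv
    _ ≤ _ := hle

end Height

end Summit.QuantumFields.YangMills.Theorems.HeightChiSqLDataProcessing

end
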